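import Literature.AlgebraicGeometry.Resolution.SmoothFactorizationsFractionRing
import Literature.AlgebraicGeometry.Resolution.NeronPopescuClearDenominators
import Literature.AlgebraicGeometry.Resolution.NeronPopescuSteps
import Literature.AlgebraicGeometry.Resolution.NeronPopescuLiftingProblem
import Mathlib.RingTheory.Localization.Algebra
import Mathlib.RingTheory.Smooth.StandardSmooth
import Mathlib.RingTheory.RingHom.FiniteType
import Mathlib.RingTheory.Flat.TorsionFree
import Mathlib.RingTheory.Noetherian.Nilpotent
import Mathlib.RingTheory.Nilpotent.Lemmas
import HarnessLib

/-!
# Stacks 07F5 from the deep lemmas 07CI, 07CP, 07CT (the glue of the proof, with 07F4 and 07CM)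

Topic: `Literature/AlgebraicGeometry/Resolution`. The named fact `Stacks07F5_reduceToField`
(`NeronPopescuSteps.lean`; Stacks, *Smoothing Ring Maps*, Lemma 07F5: "If for every Situation
07F2 where `R` is a field PT holds, then PT holds in general") is proved in Stacks from five
substantial inputs of the same chapter — Proposition 07CM (lifting PT along a nilpotent
thickening), Lemmas 07CH/07CI (smooth factorisations may be taken standard smooth), Lemma 07F4
(clearing denominators: an elementary standard element from a standard smooth factorisation
over `S⁻¹R`), the lifting lemma 07CP and the desingularization lemma 07CT —
together with More on Algebra 07C1, Lemma 07F3 and Algebra 00EW/02LX. The latter and the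
frame of the proof are PROVED in the sibling files `SmoothFactorizationsTransport.lean`,
`SmoothFactorizationsBaseInduction.lean` (Noetherian induction on `R`, 07C1),
`SmoothFactorizationsProduct.lean` (07F3) and `SmoothFactorizationsFractionRing.lean`
(`Q = K₁ × … × K_n`), Lemma 07F4 itself (for a standard smooth `B'`) is PROVED in
`NeronPopescuClearDenominators.lean`, and Proposition 07CM is PROVED (with standard smooth
factorisations in its hypothesis) in `NeronPopescuLiftingProblem.lean`
(`Stacks07CM_exists_smooth_factorization`). This file PROVES THE REMAINING GLUE: the theorem
`Stacks07F5_reduceToField_of` deduces `Stacks07F5_reduceToField` from the three remaining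
deep inputs 07CI (with 07CH), 07CP, 07CT, each taken as an explicitly stated hypothesis
(no named fact is introduced; when these three are proved in the tree,
`Stacks07F5_reduceToField_holds` is the one-line application).

The printed proof (after the Noetherian induction and the reduction to `S⁻¹R → S⁻¹Λ`):

> In particular, we see by applying Proposition 07CM that `R` is a reduced ring. Let `A → Λ`
> be an `R`-algebra homomorphism with `A` of finite presentation. We have to find a
> factorization `A → B → Λ` with `B` smooth over `R` … Hence we can find a factorization
> `S⁻¹A → B' → S⁻¹Λ` with `B'` smooth over `S⁻¹R`. We apply Lemma 07F4 and find a
> factorization `A → B → Λ` such that some `π ∈ S` is elementary standard in `B` over `R`.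
> After replacing `A` by `B` we may assume that `π` is elementary standard, hence strictly
> standard in `A`. We know that `R/π⁸R → Λ/π⁸Λ` satisfies PT. Hence we can find a
> factorization `R/π⁸R → A/π⁸A → C̄ → Λ/π⁸Λ` with `R/π⁸R → C̄` smooth. By Lemma 07CP we can
> find an `R`-algebra map `D → Λ` with `D` smooth over `R` and a factorization
> `R/π⁴R → A/π⁴A → D/π⁴D → Λ/π⁴Λ`. By Lemma 07CT we can find `A → B → Λ` with `B` smooth
> over `R` which finishes the proof.

## The three hypotheses (renderings of the deep inputs, as consumed)

* `hCI` — **07CI** (with 07CH; factorisation form): if PT holds for `R → Λ` then every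
  finitely presented `A → Λ` factors through a *standard* smooth `R`-algebra
  (`HasStandardSmoothFactorizations`, `NeronPopescuLiftingProblem.lean`; Mathlib's
  `Algebra.IsStandardSmooth`). It is used twice: as the first sentence of the proof of 07F4
  ("We first apply Lemma 07CH to `S⁻¹R → B'`. Thus we may assume `B'` is standard smooth over
  `S⁻¹R`"), and to feed Proposition 07CM, whose hypothesis is in standard smooth form.
* `hCP` — **07CP in the form used by 07F5** (`C̄` smooth over `R/π²R`, so that conclusions
  (2), (3) say that `D` is smooth over `R`): `R` Noetherian, `Ann_R(π) = Ann_R(π²)`,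
  `Ann_Λ(π) = Ann_Λ(π²)`, `R/π²R → C̄ → Λ/π²Λ` with `C̄` smooth over `R/π²R` ⇒ an `R`-algebra
  map `D → Λ` with `D` smooth over `R` and `C̄ → D/πD` compatible with `Λ/π²Λ → Λ/πΛ`
  (compatibility stated on representatives).
* `hCT` — **07CT as used** (the inclusion `H_{D/R}B ⊆ H_{B/R}`): `R` Noetherian, the same
  annihilator conditions, `A → Λ`, `D → Λ` with `A`, `D` finitely presented, `π` strictly
  standard in `A` over `R`, `A/π⁴A → D/π⁴D` compatible with the maps to `Λ/π⁴Λ` ⇒ `B`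
  finitely presented with `A → B → Λ`, `D → B → Λ` and `H_{D/R}B ⊆ H_{B/R}`
  (`singularIdeal`, `NeronPopescuSingularIdeal.lean`).

## Sources

* The Stacks Project, *Smoothing Ring Maps* (Tag 07BW): Lemma 07F5 and its proof;
  Proposition 07CM, Lemmas 07CI, 07F4, 07CP, 07CT, Definition 07C7. [StacksProject]
-/

noncomputable section

open TensorProduct nonZeroDivisors

namespace Literature.AlgebraicGeometry.Resolution

universe u

/-! ## Small lemmas -/

section Lemmas

variable {R : Type u} [CommRing R]

/-- A non-zero-divisor `π` has `Ann(π) = Ann(π²)` (both are zero). [folklore] -/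
theorem ann_eq_ann_sq_of_mem_nonZeroDivisors {π : R} (hπ : π ∈ R⁰) (r : R) (h : π ^ 2 * r = 0) :
    π * r = 0 := by
  have hr : r = 0 := by
    have h2 : π ^ 2 ∈ R⁰ := pow_mem hπ 2
    rw [mul_comm] at h
    exact (mem_nonZeroDivisors_iff_right.mp h2) r h
  rw [hr, mul_zero]

/-- Over a flat algebra a non-zero-divisor `π` of `R` stays a non-zero-divisor, so
`Ann_Λ(π) = Ann_Λ(π²)`. [folklore] -/
theorem ann_eq_ann_sq_algebraMap_of_flat {Λ : Type u} [CommRing Λ] [Algebra R Λ] [Module.Flat R Λ]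
    {π : R} (hπ : π ∈ R⁰) (x : Λ) (h : algebraMap R Λ π ^ 2 * x = 0) :
    algebraMap R Λ π * x = 0 := by
  have hreg : IsSMulRegular Λ (π ^ 2) := Module.Flat.isSMulRegular_of_nonZeroDivisors (pow_mem hπ 2)
  have hx : x = 0 := by
    apply hreg
    change (π ^ 2) • x = (π ^ 2) • (0 : Λ)
    rw [smul_zero, Algebra.smul_def, map_pow, h]
  rw [hx, mul_zero]

end Lemmas

/-! ## The glue -/

section Glue

/-- **Stacks 07F5 from 07CI, 07CP, and 07CT for smooth `D`** (and the proved 07F4,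
`exists_elementaryStandard_factorization`, and 07CM, `Stacks07CM_exists_smooth_factorization`).
See the module docstring for the three hypotheses (here `hCT` carries the extra hypothesis
`Algebra.Smooth R D`, the only case in which the printed proof applies 07CT: "Since `D` is smooth
over `R`"); the conclusion is the named fact `Stacks07F5_reduceToField` ("PT over fields
implies PT for all regular homomorphisms of Noetherian rings"). The proof is the printed one:
Noetherian induction on `R` (`hasSmoothFactorizations_of_forall_quotient`), `R` reduced by
07CM applied to the nilradical (07CI supplying standard smooth factorisations over `R/N`), PT for `S⁻¹R → S⁻¹Λ` by the field case, 02LX and 07F3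
(`hasSmoothFactorizations_isFractionRing_of_field`), a standard smooth factorisation (07CI),
then 07F4, PT for `R/π⁸R → Λ/π⁸Λ`,
07CP with `π⁴` and 07CT with `π`, and finally `H_{D/R} = D` (as `D` is smooth) forces
`H_{B/R} = B`, i.e. `B` smooth (`singularIdeal_eq_top_iff`). [cite: StacksProject, Tag 07F5] -/
theorem Stacks07F5_reduceToField_of_smooth
    (hCI : ∀ (R Λ : Type u) [CommRing R] [CommRing Λ] [Algebra R Λ],
      HasSmoothFactorizations R Λ → HasStandardSmoothFactorizations R Λ)
    (hCP : ∀ (R Λ : Type u) [CommRing R] [CommRing Λ] [Algebra R Λ] (π : R),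
      IsNoetherianRing R →
      (∀ r : R, π ^ 2 * r = 0 → π * r = 0) →
      (∀ x : Λ, algebraMap R Λ π ^ 2 * x = 0 → algebraMap R Λ π * x = 0) →
      ∀ (C : Type u) [CommRing C] [Algebra R C] [Algebra (R ⧸ Ideal.span {π ^ 2}) C]
        [IsScalarTower R (R ⧸ Ideal.span {π ^ 2}) C],
        Algebra.Smooth (R ⧸ Ideal.span {π ^ 2}) C →
      ∀ (γ : C →ₐ[R] Λ ⧸ (Ideal.span {π ^ 2}).map (algebraMap R Λ)),
      ∃ (D : Type u) (_ : CommRing D) (_ : Algebra R D), Algebra.Smooth R D ∧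
        ∃ (δ : D →ₐ[R] Λ) (ε : C →ₐ[R] D ⧸ (Ideal.span {π}).map (algebraMap R D)),
          ∀ (c : C) (d : D) (l : Λ), Ideal.Quotient.mk _ d = ε c → Ideal.Quotient.mk _ l = γ c →
            Ideal.Quotient.mk ((Ideal.span {π}).map (algebraMap R Λ)) (δ d) =
              Ideal.Quotient.mk ((Ideal.span {π}).map (algebraMap R Λ)) l)
    (hCT : ∀ (R Λ : Type u) [CommRing R] [CommRing Λ] [Algebra R Λ] (π : R),
      IsNoetherianRing R →
      (∀ r : R, π ^ 2 * r = 0 → π * r = 0) →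
      (∀ x : Λ, algebraMap R Λ π ^ 2 * x = 0 → algebraMap R Λ π * x = 0) →
      ∀ (A D : Type u) [CommRing A] [CommRing D] [Algebra R A] [Algebra R D],
        Algebra.FinitePresentation R A → Algebra.FinitePresentation R D → Algebra.Smooth R D →
      ∀ (α : A →ₐ[R] Λ) (δ : D →ₐ[R] Λ), IsStrictlyStandard R (algebraMap R A π) →
      ∀ (ρ : (A ⧸ (Ideal.span {π ^ 4}).map (algebraMap R A)) →ₐ[R]
          (D ⧸ (Ideal.span {π ^ 4}).map (algebraMap R D))),
        (∀ (a : A) (d : D), Ideal.Quotient.mk _ d = ρ (Ideal.Quotient.mk _ a) →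
          Ideal.Quotient.mk ((Ideal.span {π ^ 4}).map (algebraMap R Λ)) (δ d) =
            Ideal.Quotient.mk ((Ideal.span {π ^ 4}).map (algebraMap R Λ)) (α a)) →
      ∃ (B : Type u) (_ : CommRing B) (_ : Algebra R B), Algebra.FinitePresentation R B ∧
        ∃ (β : B →ₐ[R] Λ) (i : A →ₐ[R] B) (j : D →ₐ[R] B),
          β.comp i = α ∧ β.comp j = δ ∧ (singularIdeal R D).map j ≤ singularIdeal R B) :
    Stacks07F5_reduceToField.{u} := by
  intro hk R₀ Λ₀ _ _ _ hR₀ hΛ₀ h₀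
  haveI := hR₀
  haveI := hΛ₀
  refine hasSmoothFactorizations_of_forall_quotient ?_ R₀ Λ₀ h₀
  -- the induction step: `R ≠ 0` Noetherian, PT for all `R/I → Λ/IΛ`, `I ≠ 0`
  intro R Λ _ _ _ _ hR hΛ h ih
  haveI := hR
  haveI := hΛ
  haveI : Module.Flat R Λ := h.1
  -- `R` is reduced, by 07CM applied to the nilradical
  by_cases hN : nilradical R = ⊥
  swap
  · -- 07CM (`NeronPopescuLiftingProblem.lean`), the standard smooth factorisations over `R/N`
    -- being supplied from PT for `R/N → Λ/NΛ` (induction hypothesis) by 07CI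
    have h₀ : HasStandardSmoothFactorizations (R ⧸ nilradical R)
        (Λ ⧸ (nilradical R).map (algebraMap R Λ)) := hCI _ _ (ih _ hN)
    intro A _ _ hA φ
    haveI : Algebra.FinitePresentation R A := (Algebra.FinitePresentation.of_finiteType).mp hA
    obtain ⟨C, _, _, hC, α, β, hαβ⟩ := Stacks07CM_exists_smooth_factorization (nilradical R)
      (IsNoetherianRing.isNilpotent_nilradical R) h₀ A φ
    exact ⟨C, inferInstance, inferInstance, hC, α, β, hαβ⟩
  haveI : IsReduced R := nilradical_eq_bot_iff.mp hN
  -- the factorisation problem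
  intro A _ _ hA φ
  haveI := hA
  haveI : Algebra.FinitePresentation R A := (Algebra.FinitePresentation.of_finiteType).mp hA
  -- PT for `S⁻¹R → S⁻¹Λ`, `S` the non-zero-divisors
  let Q : Type u := Localization (R⁰)
  let AS : Type u := Localization (Algebra.algebraMapSubmonoid A R⁰)
  let ΛS : Type u := Localization (Algebra.algebraMapSubmonoid Λ R⁰)
  have hQ : HasSmoothFactorizations Q ΛS := hasSmoothFactorizations_isFractionRing_of_field hk h Q ΛS
  -- the localised map `S⁻¹A → S⁻¹Λ` and a smooth factorisation of it
  let φS : AS →ₐ[Q] ΛS := IsLocalization.mapₐ R⁰ Q AS ΛS φ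
  have hφS : ∀ a : A, φS (algebraMap A AS a) = algebraMap Λ ΛS (φ a) := fun a => by
    change (IsLocalization.mapₐ R⁰ Q AS ΛS φ : AS → ΛS) (algebraMap A AS a) = _
    rw [IsLocalization.mapₐ_coe, IsLocalization.map_eq]
    rfl
  have hAS : Algebra.FiniteType Q AS := by
    haveI : IsLocalization (R⁰.map (algebraMap R A)) AS :=
      (inferInstance : IsLocalization (Algebra.algebraMapSubmonoid A R⁰) AS)
    have hft := RingHom.finiteType_localizationPreserves (algebraMap R A) R⁰ Q AS
      (RingHom.finiteType_algebraMap.mpr inferInstance)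
    exact RingHom.finiteType_algebraMap.mp hft
  haveI : IsNoetherianRing Q := IsLocalization.isNoetherianRing R⁰ Q inferInstance
  haveI := hAS
  have hASfp : Algebra.FinitePresentation Q AS := (Algebra.FinitePresentation.of_finiteType).mp hAS
  obtain ⟨B', _, _, hB', v', w', hvw'⟩ := hCI Q ΛS hQ AS hASfp φS
  -- 07F4: `A → B → Λ` with `π ∈ S` elementary standard in `B`
  haveI : Algebra.IsStandardSmooth Q B' := hB'
  obtain ⟨B, _, _, v, w, hvw, π, hπS, hπel⟩ :=
    exists_elementaryStandard_factorization R A Λ φ R⁰ Q AS ΛS φS hφS B' v' w' hvw'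
  haveI : Algebra.FinitePresentation R B := hπel.finitePresentation
  have hπst : IsStrictlyStandard R (algebraMap R B π) := hπel.isStrictlyStandard
  suffices hw : FactorsThroughSmooth R w from FactorsThroughSmooth.of_comp v hw hvw
  -- annihilator conditions for `π` and `ϖ = π⁴`
  have hϖS : π ^ 4 ∈ R⁰ := pow_mem hπS 4
  have hAnnR : ∀ r : R, (π ^ 4) ^ 2 * r = 0 → π ^ 4 * r = 0 :=
    ann_eq_ann_sq_of_mem_nonZeroDivisors hϖS
  have hAnnΛ : ∀ x : Λ, algebraMap R Λ (π ^ 4) ^ 2 * x = 0 → algebraMap R Λ (π ^ 4) * x = 0 :=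
    ann_eq_ann_sq_algebraMap_of_flat hϖS
  have hAnnRπ : ∀ r : R, π ^ 2 * r = 0 → π * r = 0 := ann_eq_ann_sq_of_mem_nonZeroDivisors hπS
  have hAnnΛπ : ∀ x : Λ, algebraMap R Λ π ^ 2 * x = 0 → algebraMap R Λ π * x = 0 :=
    ann_eq_ann_sq_algebraMap_of_flat hπS
  -- PT for `R/π⁸R → Λ/π⁸Λ` applied to `B/π⁸B → Λ/π⁸Λ`
  set I8 : Ideal R := Ideal.span {(π ^ 4) ^ 2} with hI8
  have hI8ne : I8 ≠ ⊥ := by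
    rw [hI8, Ne, Ideal.span_singleton_eq_bot]
    exact nonZeroDivisors.ne_zero (pow_mem hϖS 2)
  have hPT8 : HasSmoothFactorizations (R ⧸ I8) (Λ ⧸ I8.map (algebraMap R Λ)) := ih I8 hI8ne
  have hle8 : I8.map (algebraMap R B) ≤ (I8.map (algebraMap R Λ)).comap w := by
    rw [Ideal.map_le_iff_le_comap]
    intro r hr
    rw [Ideal.mem_comap, Ideal.mem_comap, AlgHom.commutes]
    exact Ideal.mem_map_of_mem _ hr
  let w8 : (B ⧸ I8.map (algebraMap R B)) →ₐ[R ⧸ I8] (Λ ⧸ I8.map (algebraMap R Λ)) :=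
    AlgHom.extendScalarsOfSurjective (Ideal.Quotient.mk_surjective (I := I8))
      (Ideal.quotientMapₐ (I8.map (algebraMap R Λ)) w hle8)
  have hB8 : Algebra.FiniteType (R ⧸ I8) (B ⧸ I8.map (algebraMap R B)) :=
    Algebra.FiniteType.of_restrictScalars_finiteType R (R ⧸ I8) _
  obtain ⟨C, _, _, hC, v8, γ8, hvγ8⟩ := hPT8 (B ⧸ I8.map (algebraMap R B)) hB8 w8
  -- `C` as an `R`-algebra
  letI : Algebra R C := ((algebraMap (R ⧸ I8) C).comp (Ideal.Quotient.mk I8)).toAlgebra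
  haveI : IsScalarTower R (R ⧸ I8) C := IsScalarTower.of_algebraMap_eq fun _ => rfl
  -- 07CP with `ϖ = π⁴`
  obtain ⟨D, _, _, hD, δ, ε, hcomm⟩ :=
    hCP R Λ (π ^ 4) inferInstance hAnnR hAnnΛ C hC (γ8.restrictScalars R)
  haveI : Algebra.Smooth R D := hD
  -- the map `ρ : B/π⁴B → D/π⁴D` induced by `B → B/π⁸B → C → D/π⁴D`
  let θ : B →ₐ[R] D ⧸ (Ideal.span {π ^ 4}).map (algebraMap R D) :=
    ε.comp (((v8.restrictScalars R)).comp (Ideal.Quotient.mkₐ R (I8.map (algebraMap R B))))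
  have hθ : ∀ b ∈ (Ideal.span {π ^ 4}).map (algebraMap R B), θ b = 0 := by
    intro b hb
    rw [Ideal.map_span, Set.image_singleton] at hb
    obtain ⟨b', rfl⟩ := Ideal.mem_span_singleton'.mp hb
    rw [map_mul, AlgHom.commutes, IsScalarTower.algebraMap_apply R D (D ⧸ _),
      Ideal.Quotient.algebraMap_eq, Ideal.Quotient.eq_zero_iff_mem.mpr
        (Ideal.mem_map_of_mem _ (Ideal.mem_span_singleton_self _)), mul_zero]
  let ρ : (B ⧸ (Ideal.span {π ^ 4}).map (algebraMap R B)) →ₐ[R]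
      (D ⧸ (Ideal.span {π ^ 4}).map (algebraMap R D)) :=
    Ideal.Quotient.liftₐ _ θ hθ
  have hρ : ∀ (b : B) (d : D), Ideal.Quotient.mk _ d = ρ (Ideal.Quotient.mk _ b) →
      Ideal.Quotient.mk ((Ideal.span {π ^ 4}).map (algebraMap R Λ)) (δ d) =
        Ideal.Quotient.mk ((Ideal.span {π ^ 4}).map (algebraMap R Λ)) (w b) := by
    intro b d hd
    refine hcomm (v8 (Ideal.Quotient.mk _ b)) d (w b) hd ?_
    change _ = γ8 (v8 (Ideal.Quotient.mk _ b))
    rw [← AlgHom.comp_apply, hvγ8]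
    rfl
  -- 07CT with `π`
  obtain ⟨B₂, _, _, hB₂fp, β, i, j, hβi, -, hH⟩ :=
    hCT R Λ π inferInstance hAnnRπ hAnnΛπ B D inferInstance inferInstance inferInstance w δ hπst ρ hρ
  haveI := hB₂fp
  -- `H_{D/R} = D`, hence `H_{B₂/R} = B₂`, i.e. `B₂` is smooth over `R`
  have htop : singularIdeal R B₂ = ⊤ := by
    refine top_le_iff.mp ?_
    calc (⊤ : Ideal B₂) = (singularIdeal R D).map j := by
          rw [singularIdeal_eq_top_of_smooth, Ideal.map_top]
      _ ≤ singularIdeal R B₂ := hH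
  have hB₂ : Algebra.Smooth R B₂ := singularIdeal_eq_top_iff.mp htop
  exact ⟨B₂, inferInstance, inferInstance, hB₂, i, β, hβi⟩

/-- **Stacks 07F5 from 07CI, 07CP, 07CT** (general `D` in `hCT`; and the proved 07F4,
`exists_elementaryStandard_factorization`, and 07CM, `Stacks07CM_exists_smooth_factorization`).
See the module docstring for the three hypotheses; the conclusion is the named fact `Stacks07F5_reduceToField` ("PT over fields
implies PT for all regular homomorphisms of Noetherian rings"). The proof is the printed one:
Noetherian induction on `R` (`hasSmoothFactorizations_of_forall_quotient`), `R` reduced by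
07CM applied to the nilradical (07CI supplying standard smooth factorisations over `R/N`), PT for `S⁻¹R → S⁻¹Λ` by the field case, 02LX and 07F3
(`hasSmoothFactorizations_isFractionRing_of_field`), a standard smooth factorisation (07CI),
then 07F4, PT for `R/π⁸R → Λ/π⁸Λ`,
07CP with `π⁴` and 07CT with `π`, and finally `H_{D/R} = D` (as `D` is smooth) forces
`H_{B/R} = B`, i.e. `B` smooth (`singularIdeal_eq_top_iff`). [cite: StacksProject, Tag 07F5] -/
theorem Stacks07F5_reduceToField_of
    (hCI : ∀ (R Λ : Type u) [CommRing R] [CommRing Λ] [Algebra R Λ],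
      HasSmoothFactorizations R Λ → HasStandardSmoothFactorizations R Λ)
    (hCP : ∀ (R Λ : Type u) [CommRing R] [CommRing Λ] [Algebra R Λ] (π : R),
      IsNoetherianRing R →
      (∀ r : R, π ^ 2 * r = 0 → π * r = 0) →
      (∀ x : Λ, algebraMap R Λ π ^ 2 * x = 0 → algebraMap R Λ π * x = 0) →
      ∀ (C : Type u) [CommRing C] [Algebra R C] [Algebra (R ⧸ Ideal.span {π ^ 2}) C]
        [IsScalarTower R (R ⧸ Ideal.span {π ^ 2}) C],
        Algebra.Smooth (R ⧸ Ideal.span {π ^ 2}) C →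
      ∀ (γ : C →ₐ[R] Λ ⧸ (Ideal.span {π ^ 2}).map (algebraMap R Λ)),
      ∃ (D : Type u) (_ : CommRing D) (_ : Algebra R D), Algebra.Smooth R D ∧
        ∃ (δ : D →ₐ[R] Λ) (ε : C →ₐ[R] D ⧸ (Ideal.span {π}).map (algebraMap R D)),
          ∀ (c : C) (d : D) (l : Λ), Ideal.Quotient.mk _ d = ε c → Ideal.Quotient.mk _ l = γ c →
            Ideal.Quotient.mk ((Ideal.span {π}).map (algebraMap R Λ)) (δ d) =
              Ideal.Quotient.mk ((Ideal.span {π}).map (algebraMap R Λ)) l)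
    (hCT : ∀ (R Λ : Type u) [CommRing R] [CommRing Λ] [Algebra R Λ] (π : R),
      IsNoetherianRing R →
      (∀ r : R, π ^ 2 * r = 0 → π * r = 0) →
      (∀ x : Λ, algebraMap R Λ π ^ 2 * x = 0 → algebraMap R Λ π * x = 0) →
      ∀ (A D : Type u) [CommRing A] [CommRing D] [Algebra R A] [Algebra R D],
        Algebra.FinitePresentation R A → Algebra.FinitePresentation R D →
      ∀ (α : A →ₐ[R] Λ) (δ : D →ₐ[R] Λ), IsStrictlyStandard R (algebraMap R A π) →
      ∀ (ρ : (A ⧸ (Ideal.span {π ^ 4}).map (algebraMap R A)) →ₐ[R]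
          (D ⧸ (Ideal.span {π ^ 4}).map (algebraMap R D))),
        (∀ (a : A) (d : D), Ideal.Quotient.mk _ d = ρ (Ideal.Quotient.mk _ a) →
          Ideal.Quotient.mk ((Ideal.span {π ^ 4}).map (algebraMap R Λ)) (δ d) =
            Ideal.Quotient.mk ((Ideal.span {π ^ 4}).map (algebraMap R Λ)) (α a)) →
      ∃ (B : Type u) (_ : CommRing B) (_ : Algebra R B), Algebra.FinitePresentation R B ∧
        ∃ (β : B →ₐ[R] Λ) (i : A →ₐ[R] B) (j : D →ₐ[R] B),
          β.comp i = α ∧ β.comp j = δ ∧ (singularIdeal R D).map j ≤ singularIdeal R B) :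
    Stacks07F5_reduceToField.{u} :=
  Stacks07F5_reduceToField_of_smooth hCI hCP
    fun R Λ _ _ _ π hN hR hΛ A D _ _ _ _ hA hD _ α δ hst ρ hρ =>
      hCT R Λ π hN hR hΛ A D hA hD α δ hst ρ hρ

end Glue

end Literature.AlgebraicGeometry.Resolution

end
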